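import Summits.BirchSwinnertonDyer.BirchSwinnertonDyer.Theorems.InertBadSignedBranchesCccOneLawOnTypeIstarZeroTwistScalarTransport
import Summits.BirchSwinnertonDyer.BirchSwinnertonDyer.Theorems.InertBadSignedBranchesCccOneLawOnTypeIstarZeroTwistScalarMultiplierValue
import Literature.NumberTheory.EllipticCurves.CyclotomicZpExtensionLayerTorsionProofs
import Literature.NumberTheory.EllipticCurves.CyclotomicZpExtension
import HarnessLib

set_option linter.dupNamespace false

/-!
# The two FRAME book-keepings of the twist-scalar law of stub 2c-T1 on crux `CccOneLawOnTypeIstarZero`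
# (stmt-BirchSwinnertonDyer-19223, route `InertBadSignedBranches`): the explicit complex-side Gauss-sum OFFSET and the
# CHARACTER DICTIONARY `ψ(γ̃)^{m_σ} = θ⁻¹(χ_cyc σ)` — file 4 of 4 (LAST) of refill hand `leafhand-bsd-inertbadsignedbran-9` g0

Def-free helper file (theorems only; `--supports stmt-BirchSwinnertonDyer-19223`); host bsd-eis-plan g43 word «file 4 of 4» (eis
STATUS l.8270), companions p836061 (`…TwistScalarTransport`), p836259 (`…TwistScalarLayerReadOff`), p836361 (`…TwistScalarMultiplierValue`).
Context: critic NOTE #66 (K8-FRAME-DEFECT) — the Gauss sum of [A] `ColPlusInterpolation` / of `hC` is taken at Lean's per-level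
`IsCyclotomicExtension.zeta m`, an opaque frame; the repair ([A′]/hC′, director (993)) names a root system.  This file lands two
FRAME-AGNOSTIC truths usable verbatim by the repair:
* §1 (complex side): for a complex embedding `ι` with `ι(ζ_m)^k = e^{2πi/m}` (`k ⊥ m`, p836061 `exists_pow_eq_stdAddChar_one`), the complex
  Gauss sum of the avatar `θ₀.ringHomComp ι` is `ι((θ₀ k)⁻¹ · Σ_{b ∈ (ℤ/m)ˣ} θ₀(b) ζ_m^b)` — the θ₀(k_ι)⁻¹-TWIST of the ι-image of the
  cyclotomic Gauss sum at Lean's `zeta m`, whose ιp-image is Kobayashi's `padicGaussSum` of the `p`-adic avatar with NO offset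
  (p836061 `padicGaussSum_ringHomComp`): the per-level offset of NOTE #66 §2, EXPLICIT (`gaussSum_ringHomComp_stdAddChar_eq_offset`).
* §2 (no Gauss sum at all): for `θ = ψ^{pⁿ−1}` (`ψ` mod `p^{n+1}`, `p` odd), a cyclotomic `κ` with variable `γ` (`IsTopGenerator`,
  `IsCyclotomicVariable`) and `m ≡ κσ (mod pⁿ)`: `ψ(γ̃)^m · θ(χ_cyc σ) = 1` (`apply_cyclotomicGenerator_pow_mul_apply_cyc_eq_one`); with
  (A5′) `χ_p(σ_c) = c` (`cyc_eq_intCast_of_cyclotomicCharacter_eq`) the `ζ^{m_c}` of p836361's closed form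
  `eq_of_hasSum_coeff_mul_katoMultiplier` IS `θ⁻¹(c)` — so `M̃(ψ(γ̃) − 1) = (c²d²n₁ − cd²n₂θ̄(c) − c²dn₃θ̄(d) + cdn₄θ̄(c)θ̄(d)) ·
  ∏_ℓ (ℓθ̄(ℓ))²·P_ℓ(θ(ℓ)ℓ⁻¹)`: (C5)'s cusp factor `R⁻` at `θ⁻¹` and the depletion Euler factors, by name, up to the unit `(ℓθ̄(ℓ))²`.
HONEST LABEL: helper lemmas; no `hC`, no stub bytes, `stub_twistScalarIstarZero` not targeted; nothing about 2c-T1, 19223, X12 or BSD is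
proved; 19223 OPEN; BSD is proved for no curve.
-/

noncomputable section

open scoped Classical

open Literature.NumberTheory.EllipticCurves Literature.NumberTheory.EllipticCurves.Kato2004
open Literature.NumberTheory.EllipticCurves.Kato2004.EulerSystemValues

namespace Summit.BirchSwinnertonDyer.BirchSwinnertonDyer.Theorems.CccOneTwistScalarDictionary

variable {p : ℕ} [Fact p.Prime]

/-! ## §1 The OTHER factor of the twist-scalar law's left side: the EXPLICIT per-level offset of the complex Gauss sum of a
## lift against Kobayashi's `padicGaussSum` (critic NOTE #66 / host L129 (c) «optional landable truth»)

NOTE #66 (K8-FRAME-DEFECT): the root of unity at which a Gauss sum is taken must be NAMED data.  p836061 §3's `k` with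
`ι(ζ_m)^k = e^{2πi/m}` is the per-level offset of the complex embedding `ι` against Lean's `IsCyclotomicExtension.zeta m`;
this section makes its effect on the Gauss sum EXPLICIT: the complex Gauss sum of the avatar `θ₀.ringHomComp ι` is
`θ₀(k)⁻¹ · ι(g(θ₀))` with `g(θ₀) = Σ_{b ∈ (ℤ/m)ˣ} θ₀(b) ζ_m^b` the cyclotomic Gauss sum AT LEAN'S `zeta m` — the same
`g(θ₀)` whose `ιp`-image is Kobayashi's `padicGaussSum` of the `p`-adic avatar (p836061 §1 `CccOneTwistScalarTransport.padicGaussSum_ringHomComp`).  So, per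
level, `τ_ℂ(θ₀.ringHomComp ι) = θ₀(k_ι)⁻¹ · ι(g)` and `τ_p(θ₀.ringHomComp ιp) = ιp(g)`: the offset is the root of unity
`θ₀(k_ι)`, uncontrolled across levels unless the frames are tied (the content of the re-typing [A′]/hC′). -/

section Offset

variable {m : ℕ} [NeZero m]

/-- A sum over `ℤ/m` of a function vanishing off the units is the sum over `(ℤ/m)ˣ`. [folklore] -/
theorem sum_eq_sum_units_of_eq_zero {M : Type*} [AddCommMonoid M] (F : ZMod m → M)
    (hF : ∀ a : ZMod m, ¬IsUnit a → F a = 0) : ∑ a : ZMod m, F a = ∑ b : (ZMod m)ˣ, F b := by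
  classical
  have himg : (Finset.univ.image (fun b : (ZMod m)ˣ ↦ (b : ZMod m))) = Finset.univ.filter IsUnit := by
    ext a
    simp only [Finset.mem_image, Finset.mem_univ, true_and, Finset.mem_filter]
    constructor
    · rintro ⟨b, rfl⟩; exact b.isUnit
    · intro ha; exact ⟨ha.unit, ha.unit_spec⟩
  rw [← Finset.sum_filter_add_sum_filter_not Finset.univ IsUnit F, ← himg,
    Finset.sum_image (fun b _ c _ h ↦ Units.ext h)]
  have h0 : ∑ a ∈ Finset.univ.filter (fun a : ZMod m ↦ ¬IsUnit a), F a = 0 :=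
    Finset.sum_eq_zero fun a ha ↦ hF a (Finset.mem_filter.mp ha).2
  rw [h0, add_zero]

set_option backward.isDefEq.respectTransparency false in
/-- **Re-indexing a cyclotomic Gauss sum** at `ζ_m^k`, `k` prime to `m`: `Σ_b θ₀(b) ζ_m^{k·b} = θ₀(k)⁻¹ · Σ_b θ₀(b) ζ_m^{b}`
(sums over `(ℤ/m)ˣ`; substitute `b ↦ k⁻¹b`). [folklore] -/
theorem sum_units_mul_zeta_pow_mul (θ₀ : DirichletCharacter (CyclotomicField m ℚ) m) {k : ℕ} (hk : k.Coprime m) :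
    ∑ b : (ZMod m)ˣ, θ₀ (b : ZMod m) *
        IsCyclotomicExtension.zeta m ℚ (CyclotomicField m ℚ) ^ (k * (b : ZMod m).val) =
      (θ₀ (k : ZMod m))⁻¹ *
        ∑ b : (ZMod m)ˣ, θ₀ (b : ZMod m) * IsCyclotomicExtension.zeta m ℚ (CyclotomicField m ℚ) ^ (b : ZMod m).val := by
  set ζ := IsCyclotomicExtension.zeta m ℚ (CyclotomicField m ℚ) with hζdef
  have hζ : IsPrimitiveRoot ζ m := IsCyclotomicExtension.zeta_spec m ℚ (CyclotomicField m ℚ)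
  set u : (ZMod m)ˣ := ZMod.unitOfCoprime k hk with hu
  have huval : ((u : ZMod m)) = (k : ZMod m) := ZMod.coe_unitOfCoprime k hk
  -- exponents only matter mod `m`
  have hpow : ∀ b : (ZMod m)ˣ, ζ ^ (k * (b : ZMod m).val) = ζ ^ ((u * b : (ZMod m)ˣ) : ZMod m).val := by
    intro b
    rw [← pow_mod_orderOf ζ (k * _), ← hζ.eq_orderOf, Units.val_mul, huval, ZMod.val_mul,
      ZMod.val_natCast, Nat.mul_mod k, Nat.mul_mod (k % m) ((b : ZMod m).val) m, Nat.mod_mod]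
  -- `θ₀(b) = θ₀(u)⁻¹ θ₀(u b)`
  have hθu : ∀ b : (ZMod m)ˣ, θ₀ (b : ZMod m) = (θ₀ (k : ZMod m))⁻¹ * θ₀ ((u * b : (ZMod m)ˣ) : ZMod m) := by
    intro b
    have hne : θ₀ (k : ZMod m) ≠ 0 := by
      rw [← huval, ← MulChar.coe_toUnitHom]; exact Units.ne_zero _
    rw [Units.val_mul, map_mul, huval, ← mul_assoc, inv_mul_cancel₀ hne, one_mul]
  calc ∑ b : (ZMod m)ˣ, θ₀ (b : ZMod m) * ζ ^ (k * (b : ZMod m).val)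
      = ∑ b : (ZMod m)ˣ, (θ₀ (k : ZMod m))⁻¹ *
          (θ₀ ((u * b : (ZMod m)ˣ) : ZMod m) * ζ ^ ((u * b : (ZMod m)ˣ) : ZMod m).val) := by
        refine Finset.sum_congr rfl fun b _ ↦ ?_
        rw [hpow b, hθu b, mul_assoc]
    _ = (θ₀ (k : ZMod m))⁻¹ *
          ∑ b : (ZMod m)ˣ, θ₀ ((u * b : (ZMod m)ˣ) : ZMod m) * ζ ^ ((u * b : (ZMod m)ˣ) : ZMod m).val := by
        rw [Finset.mul_sum]
    _ = (θ₀ (k : ZMod m))⁻¹ * ∑ b : (ZMod m)ˣ, θ₀ (b : ZMod m) * ζ ^ (b : ZMod m).val := by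
        congr 1
        exact Fintype.sum_equiv (Equiv.mulLeft u) _ _ (fun _ ↦ rfl)

set_option backward.isDefEq.respectTransparency false in
/-- **The complex Gauss sum of a lift, with its offset EXPLICIT.**  For `ι(ζ_m)^k = e^{2πi/m}` (`k ⊥ m`,
`exists_pow_eq_stdAddChar_one`): `gaussSum (θ₀.ringHomComp ι) stdAddChar = θ₀(k)⁻¹-twisted ι-image of the cyclotomic Gauss
sum at Lean's `zeta m` over the units` — i.e. `= ι((θ₀ k)⁻¹ · Σ_{b ∈ (ℤ/m)ˣ} θ₀(b) ζ_m^b)`; compare p836061 §1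
`CccOneTwistScalarTransport.padicGaussSum_ringHomComp`: `padicGaussSum … (θ₀.ringHomComp ιp) = ιp(Σ_b θ₀(b) ζ_m^b)` (NO offset).  The root of unity
`θ₀(k_ι)` is the per-level datum NOTE #66 asks to be named. [cite: MazurTateTeitelbaum1986Invent, §I.8 (8.6)]
[cite: Kobayashi2003, Prop. 8.26 (p. 25)] -/
theorem gaussSum_ringHomComp_stdAddChar_eq_offset (ι : CyclotomicField m ℚ →+* ℂ)
    (θ₀ : DirichletCharacter (CyclotomicField m ℚ) m) {k : ℕ} (hk : k.Coprime m)
    (hkζ : ι (IsCyclotomicExtension.zeta m ℚ (CyclotomicField m ℚ)) ^ k = ZMod.stdAddChar (1 : ZMod m)) :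
    gaussSum (θ₀.ringHomComp ι) (ZMod.stdAddChar (N := m)) =
      ι ((θ₀ (k : ZMod m))⁻¹ *
        ∑ b : (ZMod m)ˣ, θ₀ (b : ZMod m) * IsCyclotomicExtension.zeta m ℚ (CyclotomicField m ℚ) ^ (b : ZMod m).val) := by
  rw [CccOneTwistScalarTransport.gaussSum_ringHomComp_stdAddChar ι θ₀ hkζ, ← sum_units_mul_zeta_pow_mul θ₀ hk]
  congr 1
  exact sum_eq_sum_units_of_eq_zero _ fun a ha ↦ by rw [MulChar.map_nonunit θ₀ ha, zero_mul]

end Offset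

/-! ## §2 The CHARACTER DICTIONARY: `ψ(γ̃)^{m_σ}` vs `θ = ψ^{pⁿ−1}` at `χ_cyc(σ)` (frame-agnostic, cf. NOTE #66) -/section Dictionary
open Literature.NumberTheory.GaloisRepresentations
variable {K : ZpExtension ℚ p} {γ : Field.absoluteGaloisGroup ℚ}
omit [Fact p.Prime] in
/-- **`ψ^{pⁿ−1}` kills `Δ`**: `b^{p−1} = 1 ⇒ (ψ^{pⁿ−1})(b) = 1` for every `ψ` mod `M` (`p − 1 ∣ pⁿ − 1`); so the
`W`-currency character `θ = ψ^{pⁿ−1}` is a character of `Gal(ℚ_n/ℚ)`. [cite: Washington1997, §13.1] -/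
theorem pow_prime_pow_sub_one_apply_eq_one_of_pow_eq_one {M : ℕ} [NeZero M] {R : Type*} [CommRing R]
    (ψ : DirichletCharacter R M) (n : ℕ) {b : (ZMod M)ˣ} (hb : b ^ (p - 1) = 1) :
    (ψ ^ (p ^ n - 1)) (b : ZMod M) = 1 := by
  obtain ⟨q, hq⟩ : (p - 1) ∣ (p ^ n - 1) := Nat.sub_one_dvd_pow_sub_one p n
  rw [MulChar.pow_apply_coe, hq, pow_mul, ← MulChar.coe_toUnitHom, ← Units.val_pow_eq_pow_val, ← map_pow, hb,
    map_one, Units.val_one, one_pow]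
/-- **`θ = ψ^{pⁿ−1}` kills `χ_cyc(Gal(ℚ̄/ℚ_n))`** (`κ` cyclotomic, `p` odd; tree
`IsCyclotomic.dirichletCharacter_apply_eq_one_of_mem_layerSubgroup`). [cite: Washington1997, §13.1] -/
theorem pow_apply_cyc_eq_one_of_mem_layerSubgroup (hκ : K.IsCyclotomic) (hp : p ≠ 2) (n : ℕ) {M : ℕ} [NeZero M]
    (hM : M = p ^ (n + 1)) {R : Type*} [CommRing R] (ψ : DirichletCharacter R M)
    {σ : Field.absoluteGaloisGroup ℚ} (hσ : σ ∈ K.layerSubgroup n) :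
    (ψ ^ (p ^ n - 1)) ((modNCyclotomicCharacter ℚ M σ : (ZMod M)ˣ) : ZMod M) = 1 :=
  hκ.dirichletCharacter_apply_eq_one_of_mem_layerSubgroup hp n hM (ψ ^ (p ^ n - 1))
    (fun _ hb ↦ pow_prime_pow_sub_one_apply_eq_one_of_pow_eq_one ψ n hb) hσ
/-- `γ^{−a}·σ ∈ Gal(ℚ̄/ℚ_n)` when `κ(σ) ≡ a (mod pⁿ)`, `κ(γ) = 1` (twin of the Kato-rigid lemma). [cite: Washington1997, §13.1] -/
theorem pow_inv_mul_mem_layerSubgroup (hγ : K.IsTopGenerator γ) {σ : Field.absoluteGaloisGroup ℚ} {a n : ℕ}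
    (ha : ((p : ℤ_[p]) ^ n) ∣ (K σ).toAdd - a) : (γ ^ a)⁻¹ * σ ∈ K.layerSubgroup n := by
  have hγ' : K γ = Multiplicative.ofAdd 1 := hγ
  rw [ZpExtension.mem_layerSubgroup, map_mul, map_inv, map_pow, hγ', ← ofAdd_nsmul, toAdd_mul, toAdd_inv,
    toAdd_ofAdd, nsmul_eq_mul, mul_one]
  rwa [sub_eq_neg_add] at ha
/-- **`θ(χ_cyc σ) = θ(χ_cyc γ)^a`** for `κ(σ) ≡ a (mod pⁿ)`, `θ` killing `χ_cyc(Gal(ℚ̄/ℚ_n))` (any-valued twin of the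
Kato-rigid `apply_cyc_eq_pow`). [cite: Washington1997, §13.1] -/
theorem apply_cyc_eq_pow (hγ : K.IsTopGenerator γ) {n M : ℕ} [NeZero M] {R : Type*} [CommMonoidWithZero R]
    (θ : DirichletCharacter R M)
    (hθ : ∀ τ ∈ K.layerSubgroup n, θ ((modNCyclotomicCharacter ℚ M τ : (ZMod M)ˣ) : ZMod M) = 1)
    {σ : Field.absoluteGaloisGroup ℚ} {a : ℕ} (ha : ((p : ℤ_[p]) ^ n) ∣ (K σ).toAdd - a) :
    θ ((modNCyclotomicCharacter ℚ M σ : (ZMod M)ˣ) : ZMod M) =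
      θ ((modNCyclotomicCharacter ℚ M γ : (ZMod M)ˣ) : ZMod M) ^ a := by
  have hτ := hθ _ (pow_inv_mul_mem_layerSubgroup hγ ha)
  have hσ : σ = γ ^ a * ((γ ^ a)⁻¹ * σ) := by group
  rw [hσ, map_mul, Units.val_mul, map_mul, hτ, mul_one, map_pow, Units.val_pow_eq_pow_val, map_pow]
/-- `toZModPow n x = a ⇒ pⁿ ∣ x − a`. [folklore] -/
theorem prime_pow_dvd_sub_of_toZModPow_eq {x : ℤ_[p]} {n a : ℕ}
    (h : PadicInt.toZModPow n x = (a : ZMod (p ^ n))) : ((p : ℤ_[p]) ^ n) ∣ x - a := by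
  rw [← Ideal.mem_span_singleton, ← PadicInt.ker_toZModPow, RingHom.mem_ker, map_sub, map_natCast, h, sub_self]
/-- **`γ` reads as `γ̃` through every character of `Gal(ℚ_n/ℚ)`** (`χ_p(γ)·ζ = γ̃`, `ζ` torsion = `χ_p` of an element of
`ker κ ≤ Gal(ℚ̄/ℚ_n)`). [cite: MazurTateTeitelbaum1986Invent, §I.13] -/
theorem apply_cyc_eq_apply_cyclotomicGenerator (hκ : K.IsCyclotomic) (hγc : IsCyclotomicVariable p γ) {n k : ℕ}
    [NeZero (p ^ k)] {R : Type*} [CommMonoidWithZero R] (θ : DirichletCharacter R (p ^ k))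
    (hθ : ∀ τ ∈ K.layerSubgroup n,
      θ ((modNCyclotomicCharacter ℚ (p ^ k) τ : (ZMod (p ^ k))ˣ) : ZMod (p ^ k)) = 1) :
    θ ((modNCyclotomicCharacter ℚ (p ^ k) γ : (ZMod (p ^ k))ˣ) : ZMod (p ^ k)) =
      θ (cyclotomicGenerator p : ZMod (p ^ k)) := by
  obtain ⟨ζ, hfin, hζ⟩ := hγc
  obtain ⟨τ, hτ⟩ := GaloisRep.cyclotomicCharacter_rat_surjective (p := p) ζ
  have hτker : τ ∈ K.kerSubgroup := by
    rw [hκ, Subgroup.mem_comap, CommGroup.mem_torsion]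
    change IsOfFinOrder (GaloisRep.cyclotomicCharacter ℚ p τ)
    rw [hτ]; exact hfin
  have h1 : θ ((modNCyclotomicCharacter ℚ (p ^ k) τ : (ZMod (p ^ k))ˣ) : ZMod (p ^ k)) = 1 :=
    hθ τ (K.kerSubgroup_le_layerSubgroup n hτker)
  have hprod : ((modNCyclotomicCharacter ℚ (p ^ k) (γ * τ) : (ZMod (p ^ k))ˣ) : ZMod (p ^ k)) =
      (cyclotomicGenerator p : ZMod (p ^ k)) := by
    rw [CyclotomicZp.modNCyclotomicCharacter_eq_toZModPow, map_mul, hτ, hζ, map_natCast]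
  calc θ ((modNCyclotomicCharacter ℚ (p ^ k) γ : (ZMod (p ^ k))ˣ) : ZMod (p ^ k))
      = θ ((modNCyclotomicCharacter ℚ (p ^ k) γ : (ZMod (p ^ k))ˣ) : ZMod (p ^ k)) *
          θ ((modNCyclotomicCharacter ℚ (p ^ k) τ : (ZMod (p ^ k))ˣ) : ZMod (p ^ k)) := by rw [h1, mul_one]
    _ = θ ((modNCyclotomicCharacter ℚ (p ^ k) (γ * τ) : (ZMod (p ^ k))ˣ) : ZMod (p ^ k)) := by
          rw [map_mul, Units.val_mul, map_mul]
    _ = θ (cyclotomicGenerator p : ZMod (p ^ k)) := by rw [hprod]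
/-- **THE DICTIONARY**: `θ = ψ^{pⁿ−1}` (`ψ` mod `p^{n+1}`, `p` odd), `κ` cyclotomic with variable `γ`, `m ≡ κσ (mod pⁿ)` ⇒
`ψ(γ̃)^m · θ(χ_cyc σ) = 1`: the `ζ^{m_σ}` of `eq_of_hasSum_coeff_mul_katoMultiplier` IS `θ⁻¹(χ_cyc σ)` (= `θ⁻¹(c)` for the (A5′)
elements, the `χ̄(c)` of (C5)'s cusp factor). [cite: Kato2004Asterisque, §13.9 (p. 229), Lemma 13.10 (1) (p. 230)] -/
theorem apply_cyclotomicGenerator_pow_mul_apply_cyc_eq_one (hκ : K.IsCyclotomic) (hγ : K.IsTopGenerator γ)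
    (hγc : IsCyclotomicVariable p γ) (hp : p ≠ 2) (n : ℕ) (ψ : DirichletCharacter ℂ_[p] (p ^ (n + 1)))
    {σ : Field.absoluteGaloisGroup ℚ} {m : ℕ} (hm : PadicInt.toZModPow n (K σ).toAdd = (m : ZMod (p ^ n))) :
    ψ (cyclotomicGenerator p : ZMod (p ^ (n + 1))) ^ m *
        (ψ ^ (p ^ n - 1)) ((modNCyclotomicCharacter ℚ (p ^ (n + 1)) σ : (ZMod (p ^ (n + 1)))ˣ) :
          ZMod (p ^ (n + 1))) = 1 := by
  haveI : NeZero (p ^ (n + 1)) := ⟨pow_ne_zero _ (Fact.out : p.Prime).ne_zero⟩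
  have hθ : ∀ τ ∈ K.layerSubgroup n, (ψ ^ (p ^ n - 1))
      ((modNCyclotomicCharacter ℚ (p ^ (n + 1)) τ : (ZMod (p ^ (n + 1)))ˣ) : ZMod (p ^ (n + 1))) = 1 :=
    fun τ hτ ↦ pow_apply_cyc_eq_one_of_mem_layerSubgroup hκ hp n rfl ψ hτ
  have he : cyclotomicExponent p = 1 := if_neg hp
  have hord := orderOf_cyclotomicGenerator p n
  rw [he] at hord
  have hfin : IsOfFinOrder (cyclotomicGenerator p : ZMod (p ^ (n + 1))) :=
    orderOf_pos_iff.mp (by rw [hord]; exact pow_pos (Fact.out : p.Prime).pos n)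
  obtain ⟨u, hu⟩ := hfin.isUnit
  have hpow : ψ (u : ZMod (p ^ (n + 1))) ^ p ^ n = 1 := by
    rw [hu]; exact CccOneTwistScalarMultiplierValue.apply_cyclotomicGenerator_pow_prime_pow hp n ψ
  rw [apply_cyc_eq_pow hγ (ψ ^ (p ^ n - 1)) hθ (prime_pow_dvd_sub_of_toZModPow_eq hm),
    apply_cyc_eq_apply_cyclotomicGenerator hκ hγc (ψ ^ (p ^ n - 1)) hθ, ← hu, MulChar.pow_apply_coe, ← mul_pow,
    ← pow_succ', Nat.sub_add_cancel (Nat.one_le_pow _ _ (Fact.out : p.Prime).pos), hpow, one_pow]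
/-- **(A5′)-elements read as their labels**: `χ_p(σ) = c` in `ℤ_p` ⇒ `χ_cyc^{(p^k)}(σ) = c mod p^k`. [cite: Kato2004Asterisque, §13.9 (p. 229)] -/
theorem cyc_eq_intCast_of_cyclotomicCharacter_eq {k : ℕ} [NeZero (p ^ k)] {σ : Field.absoluteGaloisGroup ℚ} {c : ℤ}
    (hc : ((GaloisRep.cyclotomicCharacter ℚ p σ : ℤ_[p]ˣ) : ℤ_[p]) = c) :
    ((modNCyclotomicCharacter ℚ (p ^ k) σ : (ZMod (p ^ k))ˣ) : ZMod (p ^ k)) = (c : ZMod (p ^ k)) := by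
  rw [CyclotomicZp.modNCyclotomicCharacter_eq_toZModPow, hc, map_intCast]
end Dictionary

end Summit.BirchSwinnertonDyer.BirchSwinnertonDyer.Theorems.CccOneTwistScalarDictionary

end
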